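import Mathlib
import HarnessLib
import Literature.NumberTheory.LFunctions.HorocycleRateHalf
import Literature.NumberTheory.LFunctions.HorocycleRHIncompleteEisenstein
import Literature.NumberTheory.LFunctions.HorocycleRateHalfStrip
import Literature.NumberTheory.LFunctions.HorocycleRateHalfArcBound
import Literature.NumberTheory.LFunctions.HorocycleUnfolding

/-!
# Discharge of `HorocycleUnfolding`: partition of unity by an incomplete Eisenstein series

This file discharges the named fact `Literature.NumberTheory.LFunctions.HorocycleUnfolding` of
the skeleton `HorocycleRateHalf.lean` (elementary proof of
`Literature.NumberTheory.LFunctions.zagier_horocycle_rate_half`): for `F` smooth on `ℍ`,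
`SL(2,ℤ)`-invariant and vanishing on `𝒟 ∩ {im > Y}` there is a strip test function `f` with
`∫₀¹ F(x+iy) dx = 2y ∑_{c ≤ N} ∑*_{a mod c} Φ_f(c²y, a/c)` (`0 < y < 1/2`, `N ≥ √(2/y)`).

What is NEW here is the partition of unity:
* the cut-off `χ₀(h) = smoothTransition(4(h - 1/2))` (`cuspCutoff`: smooth, `= 0` on `h ≤ 1/2`,
  `= 1` on `h ≥ 3/4`) and the incomplete Eisenstein series `E₀ = incEis χ₀`
  (tree, `HorocycleRHIncompleteEisenstein.lean`), which is smooth, `SL(2,ℤ)`-invariant and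
  `≥ 1` on `ℍ` (`one_le_incEis_cuspCutoff`: move `z` into `𝒟`, where `im ≥ √3/2 > 3/4`);
* the automorphized function `f = F χ₀(im ·)/E₀` is a strip test function
  (`isStripFun_automorphize`, `Y₁ = max Y 1`), and `F = ∑_{(c,d)=1} F χ₀,_{(c,d)}/E₀` with
  `F χ₀(im γz)/E₀ = f(γz)` for `γ ∈ SL(2,ℤ)` with bottom row `(c, d)` (`unfoldCell_bottom_row`),
  i.e. `F` is the incomplete Poincaré series `P_f` of the twin file `HorocycleUnfolding.lean`
  (`eq_tsum_summand`).
The unfolding itself is then the twin's `HorocycleUnfolding.horocycleAverage_poincare`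
(landed for `zagier_sarnak_horocycle_rate_half`; reused, not re-proved): its term
`2 ∫₀¹ f(x+iy) dx` vanishes for `y < 1/2`, its horocycle integrals are arc transforms
(`arcTransform_eq_integral_hpt`, `HorocycleRateHalfArcBound.lean`), and the rows `c > √(2/y)`
vanish (`IsStripFun.arcTransform_eq_zero_of_two_lt`). Everything here is PROVED.

## Mathlib / tree search
Mathlib: `Real.smoothTransition`, `ModularGroup.exists_smul_mem_fd`,
`ModularGroup.three_le_four_mul_im_sq_of_mem_fd`, `IsCoprime.exists_SL2_row`,
`UpperHalfPlane.modular_T_zpow_smul`. Tree: `incEis`, `contDiffOn_incEis`, `incEis_smul`,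
`incEisTerm_eq_zero_of_not_mem_pairBox` (`HorocycleRHIncompleteEisenstein.lean`),
`HorocycleUnfolding.apply_smul_eq`, `HorocycleUnfolding.horocycleAverage_poincare`.

## References
* H. Iwaniec, *Spectral Methods of Automorphic Forms*, 2nd ed., AMS GSM 53 (2002), §3.2, §3.4
  [Iwaniec2002].
-/

noncomputable section

open Real Complex MeasureTheory Set Filter intervalIntegral EisensteinSeries
open scoped Topology MatrixGroups UpperHalfPlane ContDiff

namespace Literature.NumberTheory.LFunctions

/-! ### The cut-off and the incomplete Eisenstein series `E₀` -/

/-- The cut-off `χ₀(h) = smoothTransition(4(h - 1/2))`. [folklore] -/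
def cuspCutoff (h : ℝ) : ℝ := Real.smoothTransition (4 * (h - 1 / 2))

/-- `χ₀` is smooth. [folklore] -/
theorem contDiff_cuspCutoff : ContDiff ℝ (⊤ : ℕ∞) cuspCutoff := by
  unfold cuspCutoff
  exact Real.smoothTransition.contDiff.comp (contDiff_const.mul (contDiff_id.sub contDiff_const))

/-- `χ₀ = 0` on `(-∞, 1/2]`. [folklore] -/
theorem cuspCutoff_of_le {h : ℝ} (hh : h ≤ 1 / 2) : cuspCutoff h = 0 :=
  Real.smoothTransition.zero_of_nonpos (by linarith)

/-- `χ₀ = 1` on `[3/4, ∞)`. [folklore] -/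
theorem cuspCutoff_of_ge {h : ℝ} (hh : 3 / 4 ≤ h) : cuspCutoff h = 1 :=
  Real.smoothTransition.one_of_one_le (by linarith)

/-- `0 ≤ χ₀`. [folklore] -/
theorem cuspCutoff_nonneg (h : ℝ) : 0 ≤ cuspCutoff h := Real.smoothTransition.nonneg _

/-- `χ₀ ≤ 1`. [folklore] -/
theorem cuspCutoff_le_one (h : ℝ) : cuspCutoff h ≤ 1 := Real.smoothTransition.le_one _

/-- The support of `χ₀` lies in `[1/2, ∞)` (the shape of hypothesis used by the `incEis` API).
[folklore] -/
theorem cuspCutoff_support (t : ℝ) (ht : cuspCutoff t ≠ 0) : 1 / 2 ≤ t := by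
  by_contra h
  exact ht (cuspCutoff_of_le (not_le.mp h).le)

/-- `E₀ = incEis χ₀` is smooth on `ℍ`. [folklore] -/
theorem contDiffOn_incEis_cuspCutoff : ContDiffOn ℝ (⊤ : ℕ∞) (incEis cuspCutoff) {z : ℂ | 0 < z.im} :=
  contDiffOn_incEis (a := 1 / 2) (by norm_num) cuspCutoff_support contDiff_cuspCutoff

/-- The summands of `E₀` are finitely supported at each `z ∈ ℍ`. [folklore] -/
theorem summable_incEisTerm_cuspCutoff {z : ℂ} (hz : 0 < z.im) :
    Summable fun v : coprimePairs => incEisTerm cuspCutoff v.1 z := by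
  classical
  obtain ⟨N, hN₀, hN₁⟩ := exists_pairBox_bound (1 / 2) z.im |z.re| z.im
  refine summable_of_ne_finset_zero (s := coprimePairBox N) fun v hv => ?_
  apply incEisTerm_eq_zero_of_not_mem_pairBox (a := 1 / 2) (by norm_num) cuspCutoff_support hz hN₀ hN₁
    le_rfl le_rfl le_rfl
  simpa [coprimePairBox, Finset.mem_subtype] using hv

/-- **`E₀ ≥ 1` on `ℍ`**: moving `z` into the fundamental domain by some `γ ∈ SL(2,ℤ)` gives
`im γz ≥ √3/2 > 3/4`, so the summand of the bottom row of `γ` equals `χ₀(im γz) = 1`, and all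
summands are `≥ 0`. [folklore] -/
theorem one_le_incEis_cuspCutoff {z : ℂ} (hz : 0 < z.im) :
    ∃ r : ℝ, 1 ≤ r ∧ incEis cuspCutoff z = (r : ℂ) := by
  refine ⟨∑' v : coprimePairs, incEisTerm cuspCutoff v.1 z, ?_, rfl⟩
  obtain ⟨γ, hγ⟩ := ModularGroup.exists_smul_mem_fd (⟨z, hz⟩ : ℍ)
  set v : Fin 2 → ℤ := (γ : Matrix (Fin 2) (Fin 2) ℤ) 1 with hv
  have hcop : IsCoprime (v 0) (v 1) := ModularGroup.bottom_row_coprime γ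
  have hvmem : v ∈ coprimePairs := (mem_gammaSet_one v).mpr hcop
  -- the summand at `v` is `χ₀(im γz) = 1`
  have him : (↑(γ • (⟨z, hz⟩ : ℍ)) : ℂ).im = z.im / Complex.normSq ((v 0 : ℂ) * z + v 1) := by
    rw [UpperHalfPlane.coe_im, ModularGroup.im_smul_eq_div_normSq γ ⟨z, hz⟩]
    simp [UpperHalfPlane.denom, hv]
  have h34 : 3 / 4 ≤ (↑(γ • (⟨z, hz⟩ : ℍ)) : ℂ).im := by
    have h3 := ModularGroup.three_le_four_mul_im_sq_of_mem_fd hγ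
    have hpos : 0 < (γ • (⟨z, hz⟩ : ℍ)).im := (γ • (⟨z, hz⟩ : ℍ)).im_pos
    rw [UpperHalfPlane.coe_im]
    nlinarith
  have hterm : incEisTerm cuspCutoff v z = 1 := by
    rw [incEisTerm, ← him]
    exact cuspCutoff_of_ge h34
  calc (1 : ℝ) = incEisTerm cuspCutoff v z := hterm.symm
    _ ≤ ∑' u : coprimePairs, incEisTerm cuspCutoff u.1 z :=
        (summable_incEisTerm_cuspCutoff hz).le_tsum ⟨v, hvmem⟩ fun u _ => cuspCutoff_nonneg _

/-- `E₀ z ≠ 0` on `ℍ`. [folklore] -/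
theorem incEis_cuspCutoff_ne_zero {z : ℂ} (hz : 0 < z.im) : incEis cuspCutoff z ≠ 0 := by
  obtain ⟨r, hr, h⟩ := one_le_incEis_cuspCutoff hz
  rw [h]; exact_mod_cast (show r ≠ 0 by linarith)

/-! ### The automorphized function -/

/-- `f = F χ₀(im ·)/E₀`. [folklore] -/
def automorphize (F : ℂ → ℂ) (z : ℂ) : ℂ := F z * (cuspCutoff z.im : ℂ) / incEis cuspCutoff z

/-- Translation by `1` is the action of `T ∈ SL(2,ℤ)`: `↑(T • z) = ↑z + 1`. [folklore] -/
theorem coe_T_smul (z : ℍ) : (↑(ModularGroup.T • z) : ℂ) = (z : ℂ) + 1 := by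
  rw [UpperHalfPlane.modular_T_smul, UpperHalfPlane.coe_vadd]; push_cast; ring

/-- Translation by `-n` is the action of `T^{-n}`: `↑(T^{-n} • z) = ↑z - n`. [folklore] -/
theorem coe_T_zpow_smul (z : ℍ) (n : ℤ) : (↑(ModularGroup.T ^ n • z) : ℂ) = (z : ℂ) + n := by
  rw [UpperHalfPlane.modular_T_zpow_smul, UpperHalfPlane.coe_vadd]; push_cast; ring

/-- A `Γ`-invariant function vanishing on `𝒟 ∩ {im > Y}` vanishes for `im z > max Y 1`
(translate `z` by an integer into `𝒟`). [folklore] -/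
theorem apply_eq_zero_of_lt_im {F : ℂ → ℂ}
    (hinv : ∀ (g : SL(2, ℤ)) (z : ℍ), F ↑(g • z) = F ↑z) {Y : ℝ}
    (hY : ∀ z : ℍ, z ∈ ModularGroup.fd → Y < z.im → F ↑z = 0) {z : ℂ} (hz : max Y 1 < z.im) :
    F z = 0 := by
  have hz0 : 0 < z.im := lt_of_le_of_lt (zero_le_one.trans (le_max_right Y 1)) hz
  set n : ℤ := round z.re with hn
  set w : ℍ := ModularGroup.T ^ (-n) • ⟨z, hz0⟩ with hw
  have hwc : (w : ℂ) = z - n := by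
    rw [hw, coe_T_zpow_smul]; push_cast; ring
  have hwim : w.im = z.im := by
    rw [← UpperHalfPlane.coe_im, hwc]; simp
  have hwre : w.re = z.re - n := by
    rw [← UpperHalfPlane.coe_re, hwc]; simp
  have hfd : w ∈ ModularGroup.fd := by
    constructor
    · rw [Complex.normSq_apply, UpperHalfPlane.coe_re, UpperHalfPlane.coe_im, hwim]
      have : 1 < z.im := lt_of_le_of_lt (le_max_right _ _) hz
      nlinarith [sq_nonneg w.re]
    · rw [hwre, hn]; exact abs_sub_round z.re
  have h1 : F ↑w = 0 := hY w hfd (by rw [hwim]; exact lt_of_le_of_lt (le_max_left _ _) hz)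
  rwa [hw, hinv] at h1

/-- **The automorphized function is a strip test function** with `Y₁ = max Y 1`. [folklore] -/
theorem isStripFun_automorphize {F : ℂ → ℂ} (hF : ContDiffOn ℝ (⊤ : ℕ∞) F {z : ℂ | 0 < z.im})
    (hinv : ∀ (g : SL(2, ℤ)) (z : ℍ), F ↑(g • z) = F ↑z) {Y : ℝ}
    (hY : ∀ z : ℍ, z ∈ ModularGroup.fd → Y < z.im → F ↑z = 0) :
    IsStripFun (max Y 1) (automorphize F) where
  smooth := by
    have hχ : ContDiff ℝ (⊤ : ℕ∞) fun z : ℂ => (cuspCutoff z.im : ℂ) :=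
      Complex.ofRealCLM.contDiff.comp (contDiff_cuspCutoff.comp Complex.imCLM.contDiff)
    have h := (hF.mul hχ.contDiffOn).mul
      (contDiffOn_incEis_cuspCutoff.inv fun z hz => incEis_cuspCutoff_ne_zero hz)
    refine h.congr fun z _ => ?_
    simp only [automorphize, div_eq_mul_inv, Pi.inv_apply]
  periodic := fun z => by
    unfold automorphize
    rcases le_or_gt z.im (1 / 2) with hz | hz
    · simp [cuspCutoff_of_le hz]
    · have hz0 : 0 < z.im := by linarith
      have h1 : F (z + 1) = F z := by
        have := hinv ModularGroup.T ⟨z, hz0⟩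
        rwa [coe_T_smul] at this
      have h2 : incEis cuspCutoff (z + 1) = incEis cuspCutoff z := by
        have := incEis_smul cuspCutoff ModularGroup.T ⟨z, hz0⟩
        rwa [coe_T_smul] at this
      simp [h1, h2]
  zero_of_im_lt := fun z hz => by
    simp [automorphize, cuspCutoff_of_le hz.le]
  zero_of_lt_im := fun z hz => by
    simp [automorphize, apply_eq_zero_of_lt_im hinv hY hz]

/-! ### The terms of the partition of unity -/

/-- The term of the partition of unity indexed by the pair `v`: `F χ₀,v / E₀`. [folklore] -/
def unfoldCell (F : ℂ → ℂ) (v : Fin 2 → ℤ) (z : ℂ) : ℂ :=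
  F z * (incEisTerm cuspCutoff v z : ℂ) / incEis cuspCutoff z

/-- For the bottom row `v` of `g ∈ SL(2,ℤ)`: `F(z) χ₀(im gz)/E₀(z) = f(gz)`. [folklore] -/
theorem unfoldCell_bottom_row {F : ℂ → ℂ} (hinv : ∀ (g : SL(2, ℤ)) (z : ℍ), F ↑(g • z) = F ↑z)
    (g : SL(2, ℤ)) (z : ℍ) :
    unfoldCell F ((g : Matrix (Fin 2) (Fin 2) ℤ) 1) z = automorphize F ↑(g • z) := by
  have him : (↑(g • z) : ℂ).im =
      (z : ℂ).im / Complex.normSq ((((g : Matrix (Fin 2) (Fin 2) ℤ) 1 0 : ℤ) : ℂ) * z +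
        (((g : Matrix (Fin 2) (Fin 2) ℤ) 1 1 : ℤ) : ℂ)) := by
    rw [UpperHalfPlane.coe_im, ModularGroup.im_smul_eq_div_normSq g z, UpperHalfPlane.coe_im]
    simp [UpperHalfPlane.denom]
  unfold unfoldCell automorphize
  rw [hinv g z, incEis_smul cuspCutoff g z, him, incEisTerm]

/-- **The partition of unity is the incomplete Poincaré series of `f`**: term by term,
`F χ₀,v/E₀ = T_f(v, ·)` in the notation of `HorocycleUnfolding.lean` (for `v₀ = 0`, `v₁ = ±1`
and the term is `f` itself; for `v₀ ≠ 0` take `γ ∈ SL(2,ℤ)` with bottom row `v`,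
`IsCoprime.exists_SL2_row`, and use `HorocycleUnfolding.apply_smul_eq`). [folklore] -/
theorem unfoldCell_eq_summand {F : ℂ → ℂ} (hinv : ∀ (g : SL(2, ℤ)) (z : ℍ), F ↑(g • z) = F ↑z)
    {Y₁ : ℝ} (hf : IsStripFun Y₁ (automorphize F)) {v : Fin 2 → ℤ} (hv : IsCoprime (v 0) (v 1))
    (z : ℍ) :
    unfoldCell F v z = (if v 0 = 0 then automorphize F z else
      automorphize F (((Int.gcdA (v 1) (v 0) : ℂ) * z - (Int.gcdB (v 1) (v 0) : ℂ)) /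
        ((v 0 : ℂ) * z + v 1))) := by
  split_ifs with h0
  · have hu : IsUnit (v 1) := by rw [h0] at hv; exact isCoprime_zero_left.mp hv
    have h1 : Complex.normSq ((v 0 : ℂ) * z + v 1) = 1 := by
      rcases Int.isUnit_iff.mp hu with h1 | h1 <;> simp [h0, h1]
    unfold unfoldCell automorphize incEisTerm
    rw [h1, div_one, UpperHalfPlane.coe_im]
  · obtain ⟨g, hg0, hg1⟩ := hv.exists_SL2_row 1
    have hvg : v = (g : Matrix (Fin 2) (Fin 2) ℤ) 1 := by
      funext i; fin_cases i
      · exact hg0.symm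
      · exact hg1.symm
    rw [hvg, unfoldCell_bottom_row hinv g z,
      HorocycleUnfolding.apply_smul_eq hf.periodic g (by rw [hg0]; exact h0) z, hg0, hg1]

/-- **`F` is the incomplete Poincaré series of `f = F χ₀(im ·)/E₀`** on `ℍ`:
`F(z) = ∑_{(c,d)=1} T_f((c,d), z)` (`∑ χ₀,v = E₀ ≠ 0`). [folklore] -/
theorem eq_tsum_summand {F : ℂ → ℂ} (hinv : ∀ (g : SL(2, ℤ)) (z : ℍ), F ↑(g • z) = F ↑z)
    {Y₁ : ℝ} (hf : IsStripFun Y₁ (automorphize F)) (z : ℍ) :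
    F z = ∑' v : coprimePairs, (if v.1 0 = 0 then automorphize F z else
      automorphize F (((Int.gcdA (v.1 1) (v.1 0) : ℂ) * z - (Int.gcdB (v.1 1) (v.1 0) : ℂ)) /
        ((v.1 0 : ℂ) * z + v.1 1))) := by
  have hE := incEis_cuspCutoff_ne_zero z.im_pos
  calc F z = F z / incEis cuspCutoff z * incEis cuspCutoff z := by field_simp
    _ = F z / incEis cuspCutoff z * ∑' v : coprimePairs, (incEisTerm cuspCutoff v.1 z : ℂ) := by
        unfold incEis; rw [Complex.ofReal_tsum]
    _ = ∑' v : coprimePairs, unfoldCell F v.1 z := by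
        rw [← tsum_mul_left]; unfold unfoldCell
        exact tsum_congr fun v => by ring
    _ = _ := tsum_congr fun v => unfoldCell_eq_summand hinv hf ((mem_gammaSet_one _).mp v.2) z

/-- The arc transform of a strip test function vanishes for `w > 2` (the whole arc lies below
height `1/2`). [folklore] -/
theorem IsStripFun.arcTransform_eq_zero_of_two_lt {Y₁ : ℝ} {f : ℂ → ℂ} (hf : IsStripFun Y₁ f)
    {w : ℝ} (hw : 2 < w) (θ : ℝ) : arcTransform f w θ = 0 := by
  unfold arcTransform
  have h0 : ∀ t : ℝ, f ((θ : ℂ) + arcPt w t) = 0 := fun t => by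
    apply hf.zero_of_im_lt
    have hw0 : 0 < w := by linarith
    have h1 : (1 : ℝ) / (w * (1 + t ^ 2)) ≤ 1 / w := by
      apply one_div_le_one_div_of_le hw0; nlinarith [sq_nonneg t]
    have h2 : 1 / w < 1 / 2 := by
      rw [div_lt_div_iff₀ hw0 two_pos]; linarith
    have : ((θ : ℂ) + arcPt w t).im = 1 / (w * (1 + t ^ 2)) := by simp [arcPt]
    rw [this]
    exact lt_of_le_of_lt h1 h2
  simp [h0]

/-! ### Discharge of the named fact -/

/-- **Discharge of `HorocycleUnfolding`** (`HorocycleRateHalf.lean`), under the canonical name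
`<Fact>_holds`: `f = F χ₀(im ·)/E₀`, `F = P_f` on the segment (`eq_tsum_summand`), the twin's
unfolding `HorocycleUnfolding.horocycleAverage_poincare` (with `a = 1/2`, `b = max (max Y 1) (1/2)`
and a box size `≥ N`), `∫₀¹ f(x+iy) dx = 0` for `y < 1/2`, horocycle integrals `=` arc transforms,
and removal of the vanishing rows `c > N ≥ √(2/y)`. Source of the unfolding: the double coset
decomposition of `Γ∞\Γ/Γ∞` and the resulting expansion of an incomplete Eisenstein/Poincaré
series on the horocycle, `E_𝔞(σ_𝔟 z|p) = δ_𝔞𝔟 p(z) + ∑_{c>0} ∑_{d mod c} ∑_n p(ω_{cd}(z+n))`.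
[cite: Iwaniec2002, §2.4 Thm. 2.7 (2.21); §3.2 (3.10); §3.4 p. 59] -/
theorem HorocycleUnfolding_holds : HorocycleUnfolding := by
  intro F hF hinv Y hY
  have hf := isStripFun_automorphize hF hinv hY
  refine ⟨automorphize F, hf, fun y hy hy2 N hN => ?_⟩
  set f := automorphize F with hf_def
  have ha : (0 : ℝ) < 1 / 2 := by norm_num
  -- a box large enough for the twin's unfolding and containing `N`
  set Nb : ℕ := ⌈1 / (1 / 2 * y) * 1 + Real.sqrt (y / (1 / 2))⌉₊ + N with hNb
  have hceil : 1 / (1 / 2 * y) * 1 + Real.sqrt (y / (1 / 2)) ≤ Nb := by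
    refine (Nat.le_ceil _).trans ?_
    simp [hNb]
  have hN₁ : 1 / (1 / 2 * y) * 1 + Real.sqrt (y / (1 / 2)) ≤ Nb := hceil
  have hN₀ : 1 / (1 / 2 * y) ≤ Nb := le_trans (by simp [Real.sqrt_nonneg]) hceil
  have hNNb : N ≤ Nb := by omega
  -- `F = P_f` on the segment
  have hpu : ∀ x ∈ uIcc (0 : ℝ) 1, F (↑x + ↑y * I) =
      ∑' v : coprimePairs, (if v.1 0 = 0 then f ((x : ℂ) + y * I) else
        f (((Int.gcdA (v.1 1) (v.1 0) : ℂ) * ((x : ℂ) + y * I) - (Int.gcdB (v.1 1) (v.1 0) : ℂ)) /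
          ((v.1 0 : ℂ) * ((x : ℂ) + y * I) + v.1 1))) := by
    intro x _
    have hz : 0 < ((x : ℂ) + (y : ℂ) * I).im := by simpa using hy
    exact eq_tsum_summand hinv hf ⟨(x : ℂ) + (y : ℂ) * I, hz⟩
  rw [intervalIntegral.integral_congr hpu,
    HorocycleUnfolding.horocycleAverage_poincare hf.contDiff.continuous hf.periodic hf.supp' ha hy
      hN₀ hN₁]
  -- the identity coset does not contribute below height `1/2`
  have h1 : ∫ x in (0 : ℝ)..1, f ((x : ℂ) + y * I) = 0 := by
    have : ∀ x : ℝ, f ((x : ℂ) + y * I) = 0 := fun x => hf.zero_of_im_lt _ (by simpa using hy2)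
    simp [this]
  rw [h1, mul_zero, zero_add]
  -- horocycle integrals are arc transforms
  have h2 : ∀ c ∈ Finset.Ioc 0 Nb, (y : ℂ) *
      ∑ r ∈ (Finset.range c).filter (fun r => Nat.Coprime c r),
        (∫ t : ℝ, f ((((r : ℝ) / c : ℝ) : ℂ) - 1 / (((((c : ℝ) ^ 2 * y : ℝ)) : ℂ) * ((t : ℂ) + I)))) =
      (y : ℂ) * ∑ r ∈ (Finset.range c).filter (fun r => Nat.Coprime c r),
        arcTransform f ((c : ℝ) ^ 2 * y) ((r : ℝ) / c) := by
    intro c hc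
    have hc0 : (0 : ℝ) < c := by exact_mod_cast (Finset.mem_Ioc.mp hc).1
    have hw : (c : ℝ) ^ 2 * y ≠ 0 := by positivity
    congr 1
    exact Finset.sum_congr rfl fun r _ => (arcTransform_eq_integral_hpt f hw _).symm
  rw [Finset.sum_congr rfl h2, ← Finset.mul_sum]
  -- the rows `c > N ≥ √(2/y)` vanish
  have hvan : ∀ c ∈ Finset.Ioc 0 Nb, c ∉ Finset.Ioc 0 N →
      ∑ a ∈ (Finset.range c).filter (fun a => Nat.Coprime c a),
        arcTransform f ((c : ℝ) ^ 2 * y) ((a : ℝ) / c) = 0 := by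
    intro c hc hcN
    rw [Finset.mem_Ioc] at hc hcN
    have hNc : N < c := by
      by_contra h; exact hcN ⟨hc.1, not_lt.mp h⟩
    have hc2 : 2 < (c : ℝ) ^ 2 * y := by
      have h3 : Real.sqrt (2 / y) < c := lt_of_le_of_lt hN (by exact_mod_cast hNc)
      rw [Real.sqrt_lt' (by exact_mod_cast (lt_of_le_of_lt (Nat.zero_le _) hNc))] at h3
      rw [div_lt_iff₀ hy] at h3
      linarith
    exact Finset.sum_eq_zero fun a _ => hf.arcTransform_eq_zero_of_two_lt hc2 _
  rw [← Finset.sum_subset (Finset.Ioc_subset_Ioc_right hNNb) hvan]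
  ring

/-- Lowercase bridge to `HorocycleUnfolding_holds` (the name under which the discharge first
landed; still used by `HorocycleRateHalfProofs.lean`). Same statement, same proof term; kept in
this file so that no importer breaks. Prefer `HorocycleUnfolding_holds`. [folklore] -/
theorem horocycleUnfolding_holds : HorocycleUnfolding := HorocycleUnfolding_holds

end Literature.NumberTheory.LFunctions

end
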